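import Mathlib
import Literature.NumberTheory.DiophantineGeometry.PartitionTableaux
import Literature.RepresentationTheory.FiniteGroups.PlancherelFewRowsTail
import Literature.RepresentationTheory.FiniteGroups.JamesModularSimpleDimensions
import HarnessLib

/-!
# The semisimple quotient of `𝔽̄₂[S_n]` is exponentially thin (conditional on James' theorem)

Topic `Literature/RepresentationTheory/FiniteGroups`. PROVED here, from ONE named fact of the tree:

* `finrank_sub_finrank_jacobson_perm_le_of_James` — assuming
  `James1978_finrank_quotient_jacobson_le` (James, LNM 682, Thm. 11.5 with Thm. 8.4 and
  Wedderburn–Artin: over a field of prime characteristic `p`,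
  `dim F[S_n]/J(F[S_n]) ≤ Σ_{μ ⊢ n p-regular} (f^μ)²`; file `JamesModularSimpleDimensions.lean`),
  there are `K > 0` and `n₀` with `n! − dim_𝕜 J(𝕜[S_n]) ≤ n!·e^{−K√n}` for all `n ≥ n₀`,
  `𝕜 = 𝔽̄₂ = AlgebraicClosure (ZMod 2)`.

Mechanism: at `p = 2` the `2`-regular partitions are those with distinct parts
(`Nat.Partition.countRestricted_two`); a partition of `n` into `ℓ` distinct parts has
`ℓ(ℓ+1) ≤ 2n`, so `ℓ ≤ (3/2)√n < 2√n`; and the Plancherel measure of the diagrams with at most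
`x√n` rows, `x < 2`, is `≤ e^{−cn}` eventually — the tree THEOREM
`sum_sq_numStandardTableaux_fewRows_le` (`PlancherelFewRowsTail.lean`, the Logan–Shepp 1977 /
Vershik–Kerov 1977 limit-shape mechanism in the hook-integral form of the tree). Hence
`dim 𝕜[S_n]/J ≤ Σ_{μ strict} (f^μ)² ≤ n!·e^{−cn} ≤ n!·e^{−c√n}` (`n ≥ 1`).

Role: this is the "semisimple floor" (layer `0` of the Loewy profile) in the two-modular
slice-rank programme for `S_n` of Blasiak–Church–Cohn–Grochow–Umans 2017, §6 and Cor. B.7 (a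
semisimple group algebra has full slice rank, so any slice-rank saving over `𝔽̄₂` must first see
that `𝕜[S_n]/J` is small): it is the registered stub `stub_semisimpleFloor` of the line
`two-modular-loewy-slice-rank` for `SnSubsetDichotomy.NoThresholdSubsetTriple`
(MatrixMultiplication), made unconditional the day `James1978_finrank_quotient_jacobson_le_holds`
lands. Numerically `Σ_{μ strict}(f^μ)²/n! ≈ e^{−0.9√n}` (`n ≤ 80`); the constant produced here
is far from optimal.

## References

* G. D. James, *The Representation Theory of the Symmetric Groups*, LNM 682 (1978), Thms 8.4,
  11.5. [JamesLNM682]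
* B. F. Logan, L. A. Shepp, *A variational problem for random Young tableaux*, Adv. Math. 26
  (1977) 206–222. [LoganShepp1977]
* J. Blasiak, T. Church, H. Cohn, J. A. Grochow, C. Umans, *Which groups are amenable to proving
  exponent two for matrix multiplication?*, arXiv:1712.02302 (2017), §6 and Cor. B.7.
  [BlasiakChurchCohnGrochowUmans2017]
-/

noncomputable section

open scoped BigOperators

namespace Literature.RepresentationTheory.FiniteGroups

open Literature.NumberTheory.DiophantineGeometry (numStandardTableaux)

/-! ## Combinatorial glue -/

/-- `2 · (1 + 2 + ⋯ + ℓ) = ℓ(ℓ+1)` over `ℤ`. [folklore] -/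
theorem sum_range_one_add_mul_two (ℓ : ℕ) :
    (∑ i ∈ Finset.range ℓ, (1 + (i : ℤ))) * 2 = ℓ * (ℓ + 1) := by
  induction ℓ with
  | zero => simp
  | succ k ih =>
    rw [Finset.sum_range_succ, add_mul, ih]
    push_cast
    ring

/-- A partition of `n` into distinct parts has at most `ℓ` parts where `ℓ(ℓ+1) ≤ 2n`
(its parts are `ℓ` distinct positive integers, so their sum is at least `1 + 2 + ⋯ + ℓ`).
[folklore] -/
theorem card_parts_mul_succ_le_of_nodup {n : ℕ} (μ : Nat.Partition n) (h : μ.parts.Nodup) :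
    Multiset.card μ.parts * (Multiset.card μ.parts + 1) ≤ 2 * n := by
  classical
  -- the parts as a finset of integers
  set m : Multiset ℤ := μ.parts.map (fun a : ℕ => (a : ℤ)) with hm
  have hnd : m.Nodup := h.map (fun a b hab => by exact_mod_cast hab)
  set s : Finset ℤ := m.toFinset with hs
  have hsval : s.val = m := by rw [hs, Multiset.toFinset_val, hnd.dedup]
  have hcard : s.card = Multiset.card μ.parts := by
    rw [Finset.card_def, hsval, hm, Multiset.card_map]
  have hsum : ∑ x ∈ s, x = (n : ℤ) := by
    rw [Finset.sum_eq_multiset_sum, Multiset.map_id', hsval, hm]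
    have hps := congrArg (fun k : ℕ => (k : ℤ)) μ.parts_sum
    push_cast at hps
    exact hps
  have hpos : ∀ x ∈ s, (1 : ℤ) ≤ x := by
    intro x hx
    rw [hs, Multiset.mem_toFinset, hm, Multiset.mem_map] at hx
    obtain ⟨a, ha, rfl⟩ := hx
    exact_mod_cast μ.parts_pos ha
  have key := Finset.sum_range_le_sum hpos
  rw [hsum, hcard] at key
  have key2 := sum_range_one_add_mul_two (Multiset.card μ.parts)
  have : (Multiset.card μ.parts : ℤ) * (Multiset.card μ.parts + 1) ≤ 2 * n := by
    rw [← key2]; linarith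
  exact_mod_cast this

/-- For a partition into distinct parts, `ℓ(μ) ≤ (3/2)·√n`. [folklore] -/
theorem card_parts_le_sqrt_of_nodup {n : ℕ} (μ : Nat.Partition n) (h : μ.parts.Nodup) :
    (Multiset.card μ.parts : ℝ) ≤ 3 / 2 * Real.sqrt n := by
  have h1 : (Multiset.card μ.parts : ℝ) * (Multiset.card μ.parts + 1) ≤ 2 * n := by
    exact_mod_cast card_parts_mul_succ_le_of_nodup μ h
  have h0 : (0 : ℝ) ≤ Multiset.card μ.parts := Nat.cast_nonneg _
  nlinarith [Real.sq_sqrt (Nat.cast_nonneg (α := ℝ) n), Real.sqrt_nonneg (n : ℝ)]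

/-- `dim_𝕜 𝕜[S_n] = n!` for `𝕜 = 𝔽̄₂`. [folklore] -/
theorem finrank_monoidAlgebra_perm (n : ℕ) :
    Module.finrank (AlgebraicClosure (ZMod 2))
      (MonoidAlgebra (AlgebraicClosure (ZMod 2)) (Equiv.Perm (Fin n))) = n.factorial := by
  rw [(MonoidAlgebra.coeffLinearEquiv (AlgebraicClosure (ZMod 2)) :
      MonoidAlgebra (AlgebraicClosure (ZMod 2)) (Equiv.Perm (Fin n)) ≃ₗ[(AlgebraicClosure (ZMod 2))]
        (Equiv.Perm (Fin n) →₀ (AlgebraicClosure (ZMod 2)))).finrank_eq,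
    Module.finrank_finsupp_self, Fintype.card_perm, Fintype.card_fin]

/-- **The semisimple quotient of `𝔽̄₂[S_n]` is exponentially thin, conditionally on James'
theorem (`h1`, the named fact `James1978_finrank_quotient_jacobson_le`).** For `𝕜 = 𝔽̄₂`
there are `K > 0` and `n₀` with `n! - dim_𝕜 J(𝕜[S_n]) ≤ n!·e^{-K√n}` for all `n ≥ n₀`.
Proof: `n! - dim J = dim 𝕜[S_n]/J ≤ Σ_{μ strict} (f^μ)²` (James; `2`-regular = distinct parts,
`Nat.Partition.countRestricted_two`) `≤ Σ_{ℓ(μ) ≤ (3/2)√n} (f^μ)² ≤ n!·e^{-cn} ≤ n!·e^{-c√n}`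
(`sum_sq_numStandardTableaux_fewRows_le` with `x = 3/2`, `n ≥ 1`). The conclusion is verbatim the
registered stub `stub_semisimpleFloor` of the line `two-modular-loewy-slice-rank`
(crux `SnSubsetDichotomy.NoThresholdSubsetTriple`). [cite: JamesLNM682, Theorem 11.5] -/
theorem finrank_sub_finrank_jacobson_perm_le_of_James
    (h1 : James1978_finrank_quotient_jacobson_le.{0}) :
    ∃ K : ℝ, 0 < K ∧ ∃ n₀ : ℕ, ∀ n ≥ n₀,
      (n.factorial : ℝ) -
          (Module.finrank (AlgebraicClosure (ZMod 2))
            (Submodule.restrictScalars (AlgebraicClosure (ZMod 2))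
              (Ring.jacobson
                (MonoidAlgebra (AlgebraicClosure (ZMod 2)) (Equiv.Perm (Fin n))))) : ℝ) ≤
        (n.factorial : ℝ) * Real.exp (-(K * Real.sqrt (n : ℝ))) := by
  classical
  obtain ⟨c, hc, n₀, hn₀⟩ :=
    sum_sq_numStandardTableaux_fewRows_le (3 / 2) (by norm_num) (by norm_num)
  refine ⟨c, hc, max n₀ 1, fun n hn => ?_⟩
  have hn₀' : n₀ ≤ n := le_trans (le_max_left _ _) hn
  have hn1 : 1 ≤ n := le_trans (le_max_right _ _) hn
  -- the algebra and its radical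
  set R := MonoidAlgebra (AlgebraicClosure (ZMod 2)) (Equiv.Perm (Fin n)) with hRdef
  haveI : Module.Finite (AlgebraicClosure (ZMod 2)) R :=
    Module.Finite.equiv (MonoidAlgebra.coeffLinearEquiv (AlgebraicClosure (ZMod 2)) :
      R ≃ₗ[(AlgebraicClosure (ZMod 2))]
        (Equiv.Perm (Fin n) →₀ (AlgebraicClosure (ZMod 2)))).symm
  -- the radical as a `𝔽̄₂`-subspace
  set Jn : Submodule (AlgebraicClosure (ZMod 2)) R :=
    Submodule.restrictScalars (AlgebraicClosure (ZMod 2)) (Ring.jacobson R) with hJn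
  -- `dim (R/J) + dim J = n!`
  have hquot : Module.finrank (AlgebraicClosure (ZMod 2)) (R ⧸ Jn) +
      Module.finrank (AlgebraicClosure (ZMod 2)) Jn = n.factorial := by
    rw [Submodule.finrank_quotient_add_finrank, finrank_monoidAlgebra_perm]
  have hq2 : Module.finrank (AlgebraicClosure (ZMod 2)) (R ⧸ Ring.jacobson R) =
      Module.finrank (AlgebraicClosure (ZMod 2)) (R ⧸ Jn) :=
    (Submodule.Quotient.restrictScalarsEquiv (AlgebraicClosure (ZMod 2))
      (Ring.jacobson R)).finrank_eq.symm
  -- James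
  haveI : Fact (Nat.Prime 2) := ⟨Nat.prime_two⟩
  have hJ : Module.finrank (AlgebraicClosure (ZMod 2)) (R ⧸ Ring.jacobson R) ≤
      ∑ μ ∈ Nat.Partition.distincts n, numStandardTableaux μ ^ 2 := by
    have := h1 2 (AlgebraicClosure (ZMod 2)) n
    rwa [Nat.Partition.countRestricted_two] at this
  -- distinct parts ⇒ few rows
  have hsub : Nat.Partition.distincts n ⊆ Finset.univ.filter
      (fun μ : Nat.Partition n => (Multiset.card μ.parts : ℝ) ≤ 3 / 2 * Real.sqrt n) := by
    intro μ hμ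
    rw [Nat.Partition.distincts, Finset.mem_filter] at hμ
    rw [Finset.mem_filter]
    exact ⟨Finset.mem_univ _, card_parts_le_sqrt_of_nodup μ hμ.2⟩
  have hle : ∑ μ ∈ Nat.Partition.distincts n, numStandardTableaux μ ^ 2 ≤
      ∑ μ ∈ Finset.univ.filter
        (fun μ : Nat.Partition n => (Multiset.card μ.parts : ℝ) ≤ 3 / 2 * Real.sqrt n),
        numStandardTableaux μ ^ 2 :=
    Finset.sum_le_sum_of_subset hsub
  have hDZ := hn₀ n hn₀'
  -- `e^{-cn} ≤ e^{-c√n}` for `n ≥ 1`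
  have hsqrt_le : Real.sqrt (n : ℝ) ≤ n := by
    have hn1' : (1 : ℝ) ≤ n := by exact_mod_cast hn1
    rw [Real.sqrt_le_left (by linarith)]
    nlinarith
  have hexp : Real.exp (-(c * n)) ≤ Real.exp (-(c * Real.sqrt (n : ℝ))) := by
    apply Real.exp_le_exp.2
    nlinarith
  have hF0 : (0 : ℝ) ≤ n.factorial := Nat.cast_nonneg _
  -- assemble
  have hnat : (n.factorial : ℝ) - (Module.finrank (AlgebraicClosure (ZMod 2)) Jn : ℝ) =
      (Module.finrank (AlgebraicClosure (ZMod 2)) (R ⧸ Ring.jacobson R) : ℝ) := by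
    rw [hq2]
    have := congrArg (fun k : ℕ => (k : ℝ)) hquot
    push_cast at this
    linarith
  rw [hnat]
  calc (Module.finrank (AlgebraicClosure (ZMod 2)) (R ⧸ Ring.jacobson R) : ℝ)
      ≤ ((∑ μ ∈ Nat.Partition.distincts n, numStandardTableaux μ ^ 2 : ℕ) : ℝ) := by
        exact_mod_cast hJ
    _ ≤ ((∑ μ ∈ Finset.univ.filter
          (fun μ : Nat.Partition n => (Multiset.card μ.parts : ℝ) ≤ 3 / 2 * Real.sqrt n),
          numStandardTableaux μ ^ 2 : ℕ) : ℝ) := by exact_mod_cast hle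
    _ ≤ (n.factorial : ℝ) * Real.exp (-(c * n)) := hDZ
    _ ≤ (n.factorial : ℝ) * Real.exp (-(c * Real.sqrt (n : ℝ))) :=
        mul_le_mul_of_nonneg_left hexp hF0

end Literature.RepresentationTheory.FiniteGroups

end
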